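import Literature.AlgebraicGeometry.HodgeTheory.HardLefschetzNFoldOfPolarizationClass
import Literature.AlgebraicGeometry.HodgeTheory.KaehlerClass
import Literature.AlgebraicGeometry.HodgeTheory.SupportedClassesIrreducible
import Literature.AlgebraicGeometry.HodgeTheory.AlgebraicClassesCup
import Literature.AlgebraicGeometry.HodgeTheory.HolomorphicBundleChernCharacterHyperplane
import Literature.AlgebraicGeometry.Motives.HodgeDecompositionHardLefschetzDischarge
import Literature.NumberTheory.Transcendental.DeRhamTheoremMultiplicative
import HarnessLib

/-!
# The hyperplane-type class moves algebraic classes: `L_θ(Nˡ H²ˡ) ⊆ N^{l+1} H^{2l+2}` (proved)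

Family `hodge`, layer `Literature/AlgebraicGeometry/HodgeTheory`. Bottom-up proofs toward the named
facts `nonempty_hardLefschetzNFold n X` (file `HardLefschetzNFold`) and
`hardLefschetz_hodgeRiemann n X` (file `HardLefschetzHodgeRiemann`): the two "support" fields of
`HardLefschetzNFold` — `hyperplaneClass_mem` ("the class `[Z]` of a cycle `Z` vanishes on
`X – Supp Z`", Voisin II proof of Lemma 9.18) and `lefschetzOperator_mem_algebraicClasses`
("`[H] ∪ [Z] = [H · Z]` for `H` a hyperplane section containing no component of `Supp Z`", Voisin II
§9.2.4 Prop. 9.20 with a MOVED hyperplane; Fulton 1998 §19.2) — PROVED for the hyperplane-type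
class `[θ] ∈ H²(X(ℂ); ℂ)` of any projective embedding `ι : X ⟶ ℙᴺ` (the class of the restricted
Fubini–Study form `θ = fubiniStudyPullbackForm`, read through a Hodge model `A` and a natural real
de Rham family `e`: `A^*[θ] = e[θ] ⊗ 1`, the idiom of `KaehlerClass`), and for all its scalar
multiples.

The device replacing the printed "moved hyperplane": `[θ]` dies on the complement
`(X ∖ X ∩ {xⱼ = 0})(ℂ)` of EVERY coordinate hyperplane section (`θ = d(Gⱼ^*α₀)` on the chart
`Mⱼ = φ⁻¹(ι⁻¹D₊(xⱼ)(ℂ))`, `AnalytificationFubiniStudyExact`), the charts `ι⁻¹D₊(xⱼ)` COVER `X`, and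
`Nˡ H²ˡ` is generated by classes dying off ONE IRREDUCIBLE closed `V` of codimension `≥ l`
(`algebraicClasses_eq_iSup_isIrreducible`, Fulton §19.1): the generic point of `V` lies in some
chart `ι⁻¹D₊(xⱼ)`, so `V ∩ {xⱼ = 0}` is a proper closed subset of `V`, of codimension `≥ l + 1` at
each of its points (strict specialisation, Hartshorne II Ex. 3.20), and supports multiply
(`cupProduct_mem_supportedClasses_of_inter`, Fulton §19.2).

* `lefschetzOperator_mem_algebraicClasses_of_iSup_eq_top`, `mem_algebraicClasses_one_of_iSup_eq_top`
  — the abstract moving lemma: a class `h ∈ H²(X(ℂ); ℂ)` dying off the complement of each member of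
  an open cover of `X` moves algebraic classes (`L_h(Nˡ H²ˡ) ⊆ N^{l+1}`) and lies in `N¹ H²`;
* `HodgeModel.restrictCompl_eq_zero_of_pullback_eq_fubiniStudy` — `[θ]` dies off every coordinate
  hyperplane section `X ∩ {xⱼ = 0}` (naturality of `e` for the open submanifold `Mⱼ`);
* `HodgeModel.lefschetzOperator_mem_algebraicClasses_of_pullback_eq_fubiniStudy`,
  `HodgeModel.mem_algebraicClasses_one_of_pullback_eq_fubiniStudy` — the two fields for `[θ]`;
* `HodgeModel.exists_hardLefschetzNFold_of_pullback_eq_fubiniStudy` — **a positive real multiple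
  `r[θ]` which is a RATIONAL class is the class of a `HardLefschetzNFold n X`**: Kähler
  (`isKaehlerClassVia_of_pullback_eq_fubiniStudyPullbackForm`), hence hard Lefschetz (hodge.S14,
  `Motives.hasHardLefschetzProperty_kaehlerClass_holds`) and of type `(1, 1)`; the cup product is
  bigraded (`cupPreservesHodgeType_of_exists_deRhamIsoFamily` with de Rham's theorem
  `exists_deRhamIsoFamily_holds`); assembled by `exists_hardLefschetzNFold_of_isPolarizationClass`;
* `nonempty_hardLefschetzNFold_of_fubiniStudy_rational`, `hardLefschetz_hodgeRiemann_of_fubiniStudy`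
  — the named facts REDUCED to exactly: the rationality of some `r[θ]`, `r > 0` (Voisin I
  Thm. 7.10 / §7.1.2: `[θ]` is a real multiple of the integral class `c₁(𝒪_X(1))`), and — for the
  Kähler package — the sign-free Hodge–Riemann anisotropy of that class on rational primitive
  `(m,m)`-classes (Voisin I Thm. 6.32, hodge.S15 transported to the cup product).

No definition and no named fact is introduced (D-0026). Consumer: the route item `OrthogonalSplit`
of `Summits/HodgeConjecture/HodgeConjecture/Theses/EndoscopicMiddleDegree` (via
`Theorems/EndoscopicMiddleDegreeOrthogonalSplitOfFacts`, conditional on `hardLefschetz_hodgeRiemann`).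

## References

* [VoisinHodgeI2002] C. Voisin, Hodge Theory and Complex Algebraic Geometry I (CUP 2002), §3.3.2
  Lemma 3.16, §6.2.3 Thm. 6.25, Rem. 6.27, §6.3.2 Thm. 6.32, §7.1.2, §7.1.3 Thm. 7.10, §11.1.2 and
  proof of Thm. 11.33.
* [VoisinHodgeII2003] C. Voisin, Hodge Theory and Complex Algebraic Geometry II (CUP 2003), §9.2.4
  Prop. 9.20 and proof of Lemma 9.18.
* [Fulton1998] W. Fulton, Intersection Theory, 2nd ed. (Springer 1998), §19.1 Lemma 19.1.1, §19.2.
* [Hartshorne1977] R. Hartshorne, Algebraic Geometry (GTM 52, 1977), II Ex. 3.20.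
* [SerreGAGA1956] J.-P. Serre, Géométrie algébrique et géométrie analytique, Ann. Inst. Fourier 6
  (1956), §2, §5.
-/

noncomputable section

open scoped Manifold ContDiff
open CategoryTheory AlgebraicGeometry

namespace Literature.AlgebraicGeometry.HodgeTheory

section HodgeTheory

open Literature.AlgebraicTopology.SingularHomology Literature.Geometry.Kaehler
open Literature.NumberTheory.Transcendental (DeRhamIsoFamily exists_deRhamIsoFamily_holds)
open Literature.AlgebraicGeometry.Motives.AnalytificationKaehler (fubiniStudyPullbackForm chartOpens
  mem_chartOpens_iff fubiniStudyPullbackForm_pullback_val_mem_exactSmoothForms)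

variable {n : ℕ} {X : Motives.SchemeOver ℂ}

/-! ### The abstract moving lemma: a class dying off the complement of each member of an open cover -/

/-- Strict specialisation raises the codimension: `g ⤳ x`, `g ≠ x`, `codim g ≥ l` ⟹
`codim x ≥ l + 1`. Local copy of `add_one_le_coheight_of_specializes` (file
`AlgebraicClassesCupAbelianVariety`, not imported to keep abelian varieties out of the closure).
[cite: Hartshorne1977, II Ex. 3.20] -/
private theorem add_one_le_coheight_of_specializes₃ {g x : X.left} (h : g ⤳ x) (hne : g ≠ x)
    {l : ℕ} (hl : (l : ℕ∞) ≤ Order.coheight g) : ((l + 1 : ℕ) : ℕ∞) ≤ Order.coheight x := by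
  have hlt : x < g := by
    refine lt_of_le_not_ge (Scheme.le_iff_specializes.2 h) fun h' ↦ hne ?_
    exact (h.antisymm (Scheme.le_iff_specializes.1 h')).eq
  calc ((l + 1 : ℕ) : ℕ∞) = (l : ℕ∞) + 1 := by push_cast; rfl
    _ ≤ Order.coheight g + 1 := add_le_add hl le_rfl
    _ ≤ Order.coheight x := Order.coheight_add_one_le hlt

/-- **A class dying off the complement of each member of an open cover moves algebraic classes.**
Let `X` be smooth projective over `ℂ`, `(Uᵢ)` an open cover of `X` and `h ∈ H²(X(ℂ); ℂ)` a class whose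
restriction to `Uᵢ(ℂ) = (X ∖ (X ∖ Uᵢ))(ℂ)` vanishes for every `i`. Then `h ∪ c ∈ N^{l+1} H^{2l+2}`
for every `c ∈ Nˡ H²ˡ(X(ℂ); ℂ)`: `Nˡ H²ˡ` is generated by classes dying off one irreducible closed `V`
of codimension `≥ l` (`algebraicClasses_eq_iSup_isIrreducible`); the generic point of `V` lies in
some `Uᵢ`, so every point of `V ∖ Uᵢ` is a strict specialisation of it, of codimension `≥ l + 1`,
and supports multiply (`cupProduct_mem_supportedClasses_of_inter`). This is Voisin II Prop. 9.20
("`cl(Z · Z') = cl(Z) ∪ cl(Z')`") with the hyperplane moved off every component of `Supp Z`, on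
the coniveau carrier. [cite: VoisinHodgeII2003, §9.2.4 Prop. 9.20] [cite: Fulton1998, §19.1 Lemma 19.1.1 and §19.2] -/
theorem lefschetzOperator_mem_algebraicClasses_of_iSup_eq_top (hX : Motives.IsSmoothProjective n X)
    {κ : Type*} {U : κ → X.left.Opens} (hU : ⨆ i, U i = ⊤) {h : complexBetti X 2}
    (hsupp : ∀ i, complexBetti.restrictCompl X ((U i : Set X.left)ᶜ) 2 h = 0)
    (l : ℕ) {c : complexBetti X (2 * l)} (hc : c ∈ algebraicClasses X l) :
    lefschetzOperator h (two_add_two_mul l) c ∈ algebraicClasses X (l + 1) := by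
  suffices hle : algebraicClasses X l ≤
      (algebraicClasses X (l + 1)).comap (lefschetzOperator h (two_add_two_mul l)) from hle hc
  rw [algebraicClasses_eq_iSup_isIrreducible hX l]
  refine iSup_le fun V ↦ iSup_le fun hVc ↦ iSup_le fun hVi ↦ iSup_le fun hVl ↦ ?_
  intro b hb
  -- the generic point of `V` and a member of the cover containing it
  have hη := hVi.isGenericPoint_genericPoint hVc
  obtain ⟨i, hi⟩ : ∃ i, hVi.genericPoint ∈ U i := by
    have hmem : hVi.genericPoint ∈ (⊤ : X.left.Opens) := trivial
    rw [← hU] at hmem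
    exact TopologicalSpace.Opens.mem_iSup.1 hmem
  have hZ : IsClosed ((U i : Set X.left)ᶜ) := (U i).isOpen.isClosed_compl
  -- `V ∖ Uᵢ` has codimension `≥ l + 1` at each of its points
  have hint : ∀ t ∈ (U i : Set X.left)ᶜ ∩ V, ((l + 1 : ℕ) : ℕ∞) ≤ Order.coheight t := by
    rintro t ⟨htU, htV⟩
    refine add_one_le_coheight_of_specializes₃ (hη.specializes htV) (fun heq ↦ htU ?_) (hVl _ hη.mem)
    rw [← heq]
    exact hi
  rw [Submodule.mem_comap, lefschetzOperator_apply]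
  exact cupProduct_mem_supportedClasses_of_inter hZ hVc hint _ (hsupp i) (LinearMap.mem_ker.1 hb)

/-- **A class dying off the complement of each member of an open cover lies in `N¹ H²`** (`X`
smooth projective, hence integral): the generic point of `X` lies in some `Uᵢ`, whose complement is
then a proper closed subset, of codimension `≥ 1` at each of its points.
[cite: VoisinHodgeII2003, proof of Lemma 9.18] -/
theorem mem_algebraicClasses_one_of_iSup_eq_top (hX : Motives.IsSmoothProjective n X)
    {κ : Type*} {U : κ → X.left.Opens} (hU : ⨆ i, U i = ⊤) {h : complexBetti X 2}
    (hsupp : ∀ i, complexBetti.restrictCompl X ((U i : Set X.left)ᶜ) 2 h = 0) :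
    h ∈ algebraicClasses X 1 := by
  haveI : IsIntegral X.left := Motives.IsSmoothProjective.isIntegral_holds hX
  obtain ⟨i, hi⟩ : ∃ i, genericPoint X.left ∈ U i := by
    have hmem : genericPoint X.left ∈ (⊤ : X.left.Opens) := trivial
    rw [← hU] at hmem
    exact TopologicalSpace.Opens.mem_iSup.1 hmem
  have hZ : IsClosed ((U i : Set X.left)ᶜ) := (U i).isOpen.isClosed_compl
  have hZne : ((U i : Set X.left)ᶜ) ≠ Set.univ := fun huniv ↦ by
    have : genericPoint X.left ∈ (U i : Set X.left)ᶜ := huniv ▸ Set.mem_univ _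
    exact this hi
  exact mem_supportedClasses_of_restrictCompl_eq_zero hZ
    (fun z hz ↦ by exact_mod_cast one_le_coheight_of_mem_of_isClosed_of_ne_univ hZ hZne hz) (hsupp i)

/-! ### The hyperplane-type class dies off every coordinate hyperplane section -/

namespace HodgeModel

variable (A : HodgeModel n X) {N : ℕ} (ι : X ⟶ Motives.projectiveSpace N ℂ) [IsClosedImmersion ι.left]
  (e : DeRhamIsoFamily 𝓘(ℝ, A.model))

/-- **`[θ]` dies off every coordinate hyperplane section.** For a Hodge model `A`, a closed
immersion `ι : X ⟶ ℙᴺ`, a NATURAL real de Rham family `e` and a class `H` with `A^* H = e[θ] ⊗ 1`,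
`θ` the restricted Fubini–Study form: the restriction of `H` to `(X ∖ X ∩ {xⱼ = 0})(ℂ) = ι⁻¹D₊(xⱼ)(ℂ)`
vanishes for every `j` — `θ` is EXACT on the open submanifold `Mⱼ = φ⁻¹(ι⁻¹D₊(xⱼ)(ℂ))`
(`fubiniStudyPullbackForm_pullback_val_mem_exactSmoothForms`: `θ = d(Gⱼ^*α₀)` there), `e` is natural
for the inclusion `Mⱼ → X^an`, `⊗ 1` is natural, and `Mⱼ ≃ ι⁻¹D₊(xⱼ)(ℂ)`
(`restrictCompl_eq_zero_of_map_val_eq_zero`). "`c₁(Lᵢ)` vanishes on `X − Dᵢ`, since `Lᵢ` is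
trivial on `X − Dᵢ`." [cite: VoisinHodgeI2002, Thm. 11.33 (proof) and §11.1.2] [cite: SerreGAGA1956, §5] -/
theorem restrictCompl_eq_zero_of_pullback_eq_fubiniStudy (he : e.IsNatural)
    (hθ : fubiniStudyPullbackForm A.model ι A.toComplexPoints ∈ closedSmoothForms 𝓘(ℝ, A.model) A.carrier ℝ 2)
    {H : complexBetti X 2}
    (hH : A.pullback 2 H = ofRealClass A.carrier 2 (e A.carrier 2
      (deRhamCohomology.mk ⟨fubiniStudyPullbackForm A.model ι A.toComplexPoints, hθ⟩)))
    (j : Fin (N + 1)) :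
    complexBetti.restrictCompl X (((Motives.GeneratingSections.affineChartData ι).U j : Set X.left)ᶜ)
      2 H = 0 := by
  set U : TopologicalSpace.Opens A.carrier := chartOpens ι A.isAnalytification j with hUdef
  haveI : SigmaCompactSpace U := A.sigmaCompactSpace_opens U
  have hval : ContMDiff 𝓘(ℝ, A.model) 𝓘(ℝ, A.model) ∞ (Subtype.val : U → A.carrier) :=
    fun z ↦ contMDiff_subtype_val z
  -- `θ` is exact on `Mⱼ`, so its de Rham class dies there
  have hmap : deRhamCohomology.map hval 2
      (deRhamCohomology.mk ⟨fubiniStudyPullbackForm A.model ι A.toComplexPoints, hθ⟩) = 0 := by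
    rw [deRhamCohomology.map_mk]
    exact (Submodule.Quotient.mk_eq_zero _).2
      (fubiniStudyPullbackForm_pullback_val_mem_exactSmoothForms ι A.isAnalytification j)
  -- naturality of `e` for `Mⱼ → X^an`
  have hnat := he U A.carrier Subtype.val hval 2
    (deRhamCohomology.mk ⟨fubiniStudyPullbackForm A.model ι A.toComplexPoints, hθ⟩)
  rw [hmap, map_zero] at hnat
  have h1 : singularCohomology.map ℝ ℝ (⟨Subtype.val, continuous_subtype_val⟩ : C(U, A.carrier)) 2
      (e A.carrier 2 (deRhamCohomology.mk ⟨fubiniStudyPullbackForm A.model ι A.toComplexPoints, hθ⟩)) = 0 :=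
    hnat.symm
  have h0 : singularCohomology.map ℂ ℂ (⟨Subtype.val, continuous_subtype_val⟩ : C(U, A.carrier)) 2
      (A.pullback 2 H) = 0 := by
    rw [hH, ← ofRealClass_map, h1, map_zero]
  -- `Mⱼ = φ⁻¹(ι⁻¹D₊(xⱼ)(ℂ))`
  have hUZ : ∀ m, m ∈ U ↔ (A.toComplexPoints m).pt ∉
      (((Motives.GeneratingSections.affineChartData ι).U j : Set X.left)ᶜ) := fun m ↦ by
    rw [hUdef, mem_chartOpens_iff, Set.mem_compl_iff, not_not]
    rfl
  exact A.restrictCompl_eq_zero_of_map_val_eq_zero U hUZ H h0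

/-- **`L_{[θ]}(Nˡ H²ˡ) ⊆ N^{l+1} H^{2l+2}`** — the field `HardLefschetzNFold.lefschetzOperator_mem_algebraicClasses`
for the hyperplane-type class `H = [θ]` of a projective embedding (read through a Hodge model and
a natural real de Rham family): the charts `ι⁻¹D₊(xⱼ)` cover `X` and `H` dies off each
`X ∩ {xⱼ = 0}` (`restrictCompl_eq_zero_of_pullback_eq_fubiniStudy`), so the abstract moving lemma
applies. [cite: VoisinHodgeII2003, §9.2.4 Prop. 9.20] [cite: Fulton1998, §19.2] -/
theorem lefschetzOperator_mem_algebraicClasses_of_pullback_eq_fubiniStudy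
    (hX : Motives.IsSmoothProjective n X) (he : e.IsNatural)
    (hθ : fubiniStudyPullbackForm A.model ι A.toComplexPoints ∈ closedSmoothForms 𝓘(ℝ, A.model) A.carrier ℝ 2)
    {H : complexBetti X 2}
    (hH : A.pullback 2 H = ofRealClass A.carrier 2 (e A.carrier 2
      (deRhamCohomology.mk ⟨fubiniStudyPullbackForm A.model ι A.toComplexPoints, hθ⟩)))
    (l : ℕ) {c : complexBetti X (2 * l)} (hc : c ∈ algebraicClasses X l) :
    lefschetzOperator H (two_add_two_mul l) c ∈ algebraicClasses X (l + 1) :=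
  lefschetzOperator_mem_algebraicClasses_of_iSup_eq_top hX
    (Motives.GeneratingSections.affineChartData ι).iSup_U
    (fun j ↦ A.restrictCompl_eq_zero_of_pullback_eq_fubiniStudy ι e he hθ hH j) l hc

/-- **`[θ] ∈ N¹ H²(X(ℂ); ℂ)`** — the field `HardLefschetzNFold.hyperplaneClass_mem` for the
hyperplane-type class of a projective embedding: it dies off the hyperplane section `X ∩ {xⱼ = 0}`
of any chart meeting `X` (cf. `exists_mem_holomorphicBundleChernCharacter_ne_zero_mem_algebraicClasses_one`,
the same for `ch₁(𝒪(-1)|_{X^an}) = -[θ/2π]` in the spelling of `A.deRham`).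
[cite: VoisinHodgeII2003, proof of Lemma 9.18] [cite: VoisinHodgeI2002, Thm. 11.33 (proof)] -/
theorem mem_algebraicClasses_one_of_pullback_eq_fubiniStudy
    (hX : Motives.IsSmoothProjective n X) (he : e.IsNatural)
    (hθ : fubiniStudyPullbackForm A.model ι A.toComplexPoints ∈ closedSmoothForms 𝓘(ℝ, A.model) A.carrier ℝ 2)
    {H : complexBetti X 2}
    (hH : A.pullback 2 H = ofRealClass A.carrier 2 (e A.carrier 2
      (deRhamCohomology.mk ⟨fubiniStudyPullbackForm A.model ι A.toComplexPoints, hθ⟩))) :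
    H ∈ algebraicClasses X 1 :=
  mem_algebraicClasses_one_of_iSup_eq_top hX (Motives.GeneratingSections.affineChartData ι).iSup_U
    fun j ↦ A.restrictCompl_eq_zero_of_pullback_eq_fubiniStudy ι e he hθ hH j

/-! ### The hard Lefschetz datum of a rational multiple of the hyperplane-type class -/

/-- **A positive multiple `r[θ]` of the hyperplane-type class which is a rational class is the class
of a hard Lefschetz datum.** For `X` smooth projective of dimension `n`, a Hodge model `A`, a closed
immersion `ι : X ⟶ ℙᴺ`, a natural multiplicative real de Rham family `e`, the class `H` with
`A^* H = e[θ] ⊗ 1` and `r > 0` with `r H` rational: there is `Λ : HardLefschetzNFold n X` with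
`Λ.hyperplaneClass = r H`. Indeed `r H` is a Kähler class of `(A, e)`
(`isKaehlerClassVia_of_pullback_eq_fubiniStudyPullbackForm`, `IsKaehlerClassVia.smul_of_pos`), hence
has the hard Lefschetz property (hodge.S14, `Motives.hasHardLefschetzProperty_kaehlerClass_holds`)
and is of type `(1, 1)`; it lies in `N¹ H²` and moves algebraic classes (this file); the cup
product is bigraded (`cupPreservesHodgeType_of_exists_deRhamIsoFamily`, de Rham's theorem
`exists_deRhamIsoFamily_holds`); `exists_hardLefschetzNFold_of_isPolarizationClass` assembles.
What is NOT supplied: the rationality of `r[θ]` for some `r > 0` (`[θ]` is a real multiple of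
`c₁(𝒪_X(1)) ∈ H²(X, ℤ)`, Voisin I Thm. 7.10), kept as the hypothesis `hrat`.
[cite: VoisinHodgeI2002, Thm. 6.25, Rem. 6.27, §7.1.2 and Thm. 7.10] [cite: VoisinHodgeII2003, §9.2.4 Prop. 9.20] -/
theorem exists_hardLefschetzNFold_of_pullback_eq_fubiniStudy
    (hX : Motives.IsSmoothProjective n X) (he : e.IsNatural) (hem : e.IsMultiplicative)
    (hθ : fubiniStudyPullbackForm A.model ι A.toComplexPoints ∈ closedSmoothForms 𝓘(ℝ, A.model) A.carrier ℝ 2)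
    {H : complexBetti X 2}
    (hH : A.pullback 2 H = ofRealClass A.carrier 2 (e A.carrier 2
      (deRhamCohomology.mk ⟨fubiniStudyPullbackForm A.model ι A.toComplexPoints, hθ⟩)))
    {r : ℝ} (hr : 0 < r) (hrat : IsRationalClass ((r : ℂ) • H)) :
    ∃ Λ : HardLefschetzNFold n X, Λ.hyperplaneClass = (r : ℂ) • H := by
  have hK : A.IsKaehlerClassVia e H := A.isKaehlerClassVia_of_pullback_eq_fubiniStudyPullbackForm e hX ι hθ hH
  have hKr : A.IsKaehlerClassVia e ((r : ℂ) • H) := hK.smul_of_pos hr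
  have hHL : HasHardLefschetzProperty ((r : ℂ) • H) n :=
    hKr.hasHardLefschetzProperty hX Motives.hasHardLefschetzProperty_kaehlerClass_holds he hem
  have h11 : IsOfHodgeType n X 2 1 1 ((r : ℂ) • H) := hKr.isOfHodgeType_one_one he
  have hcup : CupPreservesHodgeType n X :=
    cupPreservesHodgeType_of_exists_deRhamIsoFamily hodgePQ_independent_of_hodgeModel_holds hX A
      (exists_deRhamIsoFamily_holds A.model)
  have hpol : IsPolarizationClass n X ((r : ℂ) • H) :=
    ⟨hrat, Submodule.smul_mem _ _ (A.mem_algebraicClasses_one_of_pullback_eq_fubiniStudy ι e hX he hθ hH), hHL⟩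
  refine exists_hardLefschetzNFold_of_isPolarizationClass hX hpol (fun l c hc ↦ ?_)
    (isOfHodgeType_lefschetzOperator_of_cupPreservesHodgeType hcup h11)
  have hsmul : lefschetzOperator ((r : ℂ) • H) (two_add_two_mul l) c =
      (r : ℂ) • lefschetzOperator H (two_add_two_mul l) c := by
    rw [lefschetzOperator_apply, lefschetzOperator_apply, map_smul, LinearMap.smul_apply]
  rw [hsmul]
  exact Submodule.smul_mem _ _
    (A.lefschetzOperator_mem_algebraicClasses_of_pullback_eq_fubiniStudy ι e hX he hθ hH l hc)

end HodgeModel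

/-! ### The named facts reduced to the rationality (and the Hodge–Riemann anisotropy) of `r[θ]` -/

/-- **`nonempty_hardLefschetzNFold n X` from the rationality of a multiple of the hyperplane-type
class.** It suffices to produce, for `X` smooth projective of dimension `n`, a Hodge model, a
closed immersion `ι : X ⟶ ℙᴺ`, a natural multiplicative real de Rham family `e`, the class `H` with
`A^* H = e[θ] ⊗ 1` and some `r > 0` with `r H` rational (Voisin I Thm. 7.10 / §7.1.2: `[θ]` is a
real multiple of the integral class `[H] = c₁(𝒪_X(1))`).
[cite: VoisinHodgeI2002, Thm. 6.25, Rem. 6.27, §7.1.2 and Thm. 7.10] -/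
theorem nonempty_hardLefschetzNFold_of_fubiniStudy_rational
    (h : Motives.IsSmoothProjective n X → ∃ (A : HodgeModel n X) (N : ℕ)
      (ι : X ⟶ Motives.projectiveSpace N ℂ) (_ : IsClosedImmersion ι.left)
      (e : DeRhamIsoFamily 𝓘(ℝ, A.model)) (_ : e.IsNatural) (_ : e.IsMultiplicative)
      (hθ : fubiniStudyPullbackForm A.model ι A.toComplexPoints ∈ closedSmoothForms 𝓘(ℝ, A.model) A.carrier ℝ 2)
      (H : complexBetti X 2) (r : ℝ),
      A.pullback 2 H = ofRealClass A.carrier 2 (e A.carrier 2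
        (deRhamCohomology.mk ⟨fubiniStudyPullbackForm A.model ι A.toComplexPoints, hθ⟩)) ∧
      0 < r ∧ IsRationalClass ((r : ℂ) • H)) :
    nonempty_hardLefschetzNFold n X := fun hX ↦ by
  obtain ⟨A, N, ι, hι, e, he, hem, hθ, H, r, hH, hr, hrat⟩ := h hX
  obtain ⟨Λ, -⟩ := A.exists_hardLefschetzNFold_of_pullback_eq_fubiniStudy ι e hX he hem hθ hH hr hrat
  exact ⟨Λ⟩

/-- **The Kähler package `hardLefschetz_hodgeRiemann d X` from the hyperplane-type class**: it
suffices to produce, for `X` smooth projective of dimension `d`, the data of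
`nonempty_hardLefschetzNFold_of_fubiniStudy_rational` (a rational positive multiple `η = r[θ]` of
the hyperplane-type class) together with the sign-free HODGE–RIEMANN ANISOTROPY of `η` on rational
primitive `(m,m)`-classes (Voisin I Thm. 6.32 at `k = 2m`, `p = q = m`: for `2m + s = d`, `y`
rational of type `(m,m)`, `L^{s+1} y = 0`, `y ≠ 0` ⟹ `Lˢ y ∪ y ≠ 0`). Hard Lefschetz, the bidegree
`(1, 1)`, `η ∈ N¹ H²` and `L_η(Nˡ H²ˡ) ⊆ N^{l+1}` are theorems (this file);
`hardLefschetz_hodgeRiemann_of_isPolarizationClass` assembles. This is the exact residue of the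
fact: Voisin I Thm. 7.10 (rationality) and Thm. 6.32 (Hodge–Riemann) for the restricted
Fubini–Study class. [cite: VoisinHodgeI2002, Thm. 6.25, Rem. 6.27, Thm. 6.32, §7.1.2 and Thm. 7.10] -/
theorem hardLefschetz_hodgeRiemann_of_fubiniStudy {d : ℕ}
    (h : Motives.IsSmoothProjective d X → ∃ (A : HodgeModel d X) (N : ℕ)
      (ι : X ⟶ Motives.projectiveSpace N ℂ) (_ : IsClosedImmersion ι.left)
      (e : DeRhamIsoFamily 𝓘(ℝ, A.model)) (_ : e.IsNatural) (_ : e.IsMultiplicative)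
      (hθ : fubiniStudyPullbackForm A.model ι A.toComplexPoints ∈ closedSmoothForms 𝓘(ℝ, A.model) A.carrier ℝ 2)
      (H : complexBetti X 2) (r : ℝ),
      A.pullback 2 H = ofRealClass A.carrier 2 (e A.carrier 2
        (deRhamCohomology.mk ⟨fubiniStudyPullbackForm A.model ι A.toComplexPoints, hθ⟩)) ∧
      0 < r ∧ IsRationalClass ((r : ℂ) • H) ∧
      (∀ (m s : ℕ) (_ : 2 * m + s = d) (y : complexBetti X (2 * m)), IsRationalClass y →
        IsOfHodgeType d X (2 * m) m m y →
        lefschetzPowTo ((r : ℂ) • H) (s + 1) (2 * m) (2 * m + 2 * (s + 1)) rfl y = 0 → y ≠ 0 →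
        cupProduct (show 2 * m + 2 * s + 2 * m = 2 * d by omega)
          (lefschetzPowTo ((r : ℂ) • H) s (2 * m) (2 * m + 2 * s) rfl y) y ≠ 0)) :
    hardLefschetz_hodgeRiemann d X := by
  refine hardLefschetz_hodgeRiemann_of_isPolarizationClass fun hX ↦ ?_
  obtain ⟨A, N, ι, hι, e, he, hem, hθ, H, r, hH, hr, hrat, hHR⟩ := h hX
  have hK : A.IsKaehlerClassVia e H := A.isKaehlerClassVia_of_pullback_eq_fubiniStudyPullbackForm e hX ι hθ hH
  have hKr : A.IsKaehlerClassVia e ((r : ℂ) • H) := hK.smul_of_pos hr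
  have hHL : HasHardLefschetzProperty ((r : ℂ) • H) d :=
    hKr.hasHardLefschetzProperty hX Motives.hasHardLefschetzProperty_kaehlerClass_holds he hem
  have hcup : CupPreservesHodgeType d X :=
    cupPreservesHodgeType_of_exists_deRhamIsoFamily hodgePQ_independent_of_hodgeModel_holds hX A
      (exists_deRhamIsoFamily_holds A.model)
  refine ⟨(r : ℂ) • H, ⟨hrat, Submodule.smul_mem _ _
    (A.mem_algebraicClasses_one_of_pullback_eq_fubiniStudy ι e hX he hθ hH), hHL⟩, fun l c hc ↦ ?_,
    hKr.isOfHodgeType_one_one he, hcup, hHR⟩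
  have hsmul : lefschetzOperator ((r : ℂ) • H) (two_add_two_mul l) c =
      (r : ℂ) • lefschetzOperator H (two_add_two_mul l) c := by
    rw [lefschetzOperator_apply, lefschetzOperator_apply, map_smul, LinearMap.smul_apply]
  rw [hsmul]
  exact Submodule.smul_mem _ _
    (A.lefschetzOperator_mem_algebraicClasses_of_pullback_eq_fubiniStudy ι e hX he hθ hH l hc)

end HodgeTheory

end Literature.AlgebraicGeometry.HodgeTheory

end
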